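import Summits.QuantumFields.YangMills.Theorems.BalabanUVNodesN11Sect3SupplyChainBorelBThm1PrintedOfScalars

/-!
# DAG node N11 — BOREL 𝐁-TERMS ALONG THE WITNESS CHAIN, VIII: the scalar fold in the `M₂`-LIGHT (log) REGIME — `3·M₁ ≤ L·M₂·(log θ.γ⁻²)^r` and `8L + 3 ≤ L·M₂·(log θ.γ⁻²)^r`
# in place of FILE VI's `3·M₁ ≤ L·M₂`, `8L + 3 ≤ L·M₂` (which FAIL at every witness family with `M₂ = 1`, e.g. K1's θ₁₅ᶜᶜᴹᵂ(j; γ): `M₁ = L^j`, `M₂ = r = 1`) — so that on the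
# `SupplierBorel` road EVERY θ-level letter except `2 ≤ cR` (and the signs ∕ `0 < M₁ ≤ M` ∕ `L·M₂ ∣ M`) is a condition on the WINDOW letter `θ.γ`

HEADER — WORK-UNIT METADATA.  Cell `pub-ymgap`, YM-PLAN Track A (D-0062 ∕ D-0149 width seats), seat `pub-ymgap-dag-n11-w1` (g2; WIDTH SEAT 1 of 4 on NODE n11 [B14]),
route `BalabanUVNodes` rev 25, item K1⁷ `StabilityBAtRecordR13SepCoPH` = stmt-QuantumFields-20542 (helper, `--kind proof --supports 20542 --as helper`, count-neutral).
[III] = [Balaban1988Convergent], [15] = [Balaban1985Variational], [B7] = [Balaban1985Averaging], [B16] = [Balaban1989LargeFieldII].  Over this seat's FILES IV–VII (the road and its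
scalar fold; `step_inInterval_top_of_flow_inInterval_min`, `provisos₁₃SepCoPH_gaussPinH`), dag-n11-w3 g3's `…N11NoExpansionNumerics` (`h3_of_log` ∕ `hR_of_log` — «the `M₂`-light
form» — and `hε_of_window` ∕ `hε3_of_window` ∕ `hε2_of_window`), dag-n11-w4 g3's `cover_row_of_partCompat_of_nesting`, K0a's `theta13OfNumerics ∕ theta13LiveOfNumerics ∕
admissible_theta13OfNumerics ∕ Stage13Params.liveRepin₁₃`.  Consumed BY NAME; nothing re-typed.

WHY THIS FILE.  dag-n11-w3 g3 INTENT-4 (`…NoExpansionNumericsAtThm1CCMW`): at K1's witness of record θ₁₅ᶜᶜᴹᵂ(j; γ) the numerics SHAPE is `M₁ = M = L^j`, `M₂ = r = p₀ = 1`; there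
FILE VI's γ-free letters `3·M₁ ≤ L·M₂` (`3L^j ≤ L`) and `8L + 3 ≤ L·M₂` (`8L + 3 ≤ L`) are FALSE, while print's rows hold because the cube side carries the factor
`R_j ≥ (log g_j⁻²)^r ≥ (log θ.γ⁻²)^r` — dag-n11-w3's `h3_of_log` ∕ `hR_of_log`.  This file restates FILE VI §6∕§7 and FILE VII §8∕§9 in that regime; the cost is the window
letter only (`θ.γ ≤ 1`, read off `θ.γ < 1`).  The row `2 ≤ cR` is untouched (and remains UNINHABITED at θ₁₅ᶜᶜᴹᵂ and at `theta13LiveOfRecord`, where `cR = 1` — LOCATED-cR,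
dag-n11-d g14; owner node00-def-K0a): no edition at those witnesses is offered.

WHAT THIS FILE PROVES (6 theorems, 0 `sorry`, 0 `def`; nothing of Bałaban asserted).
§10 ★★★ `noExpansionObligation_of_gaussCert_of_supplierBorel_of_nesting_of_logScalars` ∕ ★★★ `supplyChainAt_of_gaussCert_of_supplierBorel_of_nesting_of_logScalars` (run level,
    generic Gaussian-class `θ` with the separated-range key) ∕ ★★★★ `thm1Printed_datumOfRecord₁₃SepCoPH_of_gaussCert_of_supplierBorel_of_nesting_of_logScalars` ∕ ★★★★★
    `thm1Printed_datumOfRecord₁₃SepCoPH_gaussPinH_of_supplierBorel_of_nesting_of_logScalars` (printed level; the NAMED certificate);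
§11 ★★★★★ `thm1Printed_datumOfRecord₁₃SepCoPH_gaussPinH_liveRepinH_of_supplierBorel_of_nesting_of_logScalars` (any H-extension of a live re-pin; selector `rfl`, `hθ₀.liveRepin₁₃`)
    ∕ ★★★★★ `thm1Printed_datumOfRecord₁₃SepCoPH_gaussPinH_theta13LiveOfNumericsH_of_supplierBorel_of_nesting_of_logScalars` (the all-numerics family; letters on `n`: `0 < n.ν.M₁ ≤ n.τ9.M`,
    `2 ≤ n.s2.cR`, `L·n.ν.M₂ ∣ n.τ9.M`, `3·n.ν.M₁ ≤ L·n.ν.M₂·(log n.γ⁻²)^(n.ν.r)`, `8L + 3 ≤ L·n.ν.M₂·(log n.γ⁻²)^(n.ν.r)`, `0 < n.ν.A₀`, `n.γ < 1`, `n.γ ≤ e^(−n.ν.p₀)`, the two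
    edge inequalities at `n.γ`; per windowed run `PartCompat₁₃`, K0's per-cube solvability, [III] §3's supplier).

HONEST FRAMING.  Helper lane of K1⁷; composition by name; nothing of [III] ∕ [15] ∕ [B7] ∕ [B16] asserted — the key, the scalars, `PartCompat₁₃`, K0's solvability and the
supplier are HYPOTHESES; no numerics meeting them is exhibited (K0 ∕ node00-def-K0a's business).  N11 NOT discharged; K1⁷ NOT closed; counts unmoved (typed 28∕28 · discharged 5∕27).
R4 closes only the conditional finite-𝕋⁴ rung `BalabanLadder.UV` of one programme at fixed `ε = L^{−K}` — NOT ℝ⁴, NOT OS, NOT a mass gap, NOT Clay.  No `sorry`, `axiom`, `def`,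
`instance`, `notation`.  Sources (SHAPE only): [III] Thm 1 p.262, Theorem p.245, §3 p.279, (2.4)–(2.5) p.255, (2.13) pp.256–257, (2.17) p.257, (3.22) p.269, (3.24)–(3.25) p.270,
(0.2) p.244; [B7] Prop. 2 p.26; [B16] Thm 1 p.355; [Balaban1987RG1] Thm 1 p.259, (0.21) p.256, (2.9) p.266; [Balaban1989LargeFieldI] (0.3)–(0.4) p.176; [15] Thm 1 (7)–(8) pp.278–279.
-/

noncomputable section

open MeasureTheory
open scoped BigOperators ENNReal NNReal Matrix.Norms.L2Operator

namespace Summit.QuantumFields.YangMills.Theorems.BalabanUVNodesN11Sect3SupplyChainBorelBThm1PrintedOfLogScalars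

open Literature.MathematicalPhysics.QuantumFieldTheory.Balaban1983to89 T4Continuum T4NestedCovariance Node00 Node00.Tk DagBinding
open B15DeterminingSets B8Eq17ClassAkV1 B14.Eq218Concrete B10Eq42TorusConstraint Step
open B14.Eq213MaximalDomains (side)
open B14.Eq213DetSet (Bj)
open Literature.MathematicalPhysics.QuantumFieldTheory.BalabanImbrieJaffe1984to88.BIJ85Eq453GaugeField (qsstarGIter0)
open BalabanUVNodesN11HistoryPinnedResidualDefs BalabanUVNodesN11RePinnedParamDefs
open BalabanUVNodesN11GaussianCertificateRows
open BalabanUVNodesN11GaussianCertificateDefs (gaussPinH gaussPinH_ζ0 gaussPinH_quad provisos₁₃CoPH_gaussPinH)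
open BalabanUVNodesN11Sect3SupplyChainDefs
open BalabanUVNodesN11Sect3SupplyChainBorelB
open BalabanUVNodesN11Sect3SupplyChainObligationsDefs
open BalabanUVNodesN11Sect3SupplyChainNode (thm1Printed_datumOfRecord₁₃CoPH_of_obligations)
open BalabanUVNodesN11Sect3SupplyChainBorelBObligationsOfSolvable
open BalabanUVNodesN11Sect3SupplyChainBorelBThm1PrintedOfSolvable
open BalabanUVNodesN11NoExpansionNumerics (h3_of_log hR_of_log hε_of_window hε3_of_window hε2_of_window)
open BalabanUVNodesN11CubeCoverRowOfNesting (cover_row_of_partCompat_of_nesting)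

variable {F : T4Family} {N : ℕ} [NeZero N]

/-! ## §10  The run-level and printed faces in the log regime -/

section RunLevel

variable (θ : Stage13HParams F N) (p : B12.RunParams)

/-- **★★★ `NoExpansionObligation θ p σ` AT A GAUSSIAN CERTIFICATE FROM SCALARS IN THE `M₂`-LIGHT REGIME** — FILE IV §3 with `h3` ∕ `hR` supplied by dag-n11-w3's `h3_of_log` ∕
`hR_of_log` (`3·M₁ ≤ L·M₂·(log θ.γ⁻²)^r`, `8L + 3 ≤ L·M₂·(log θ.γ⁻²)^r`, `θ.γ ≤ 1` from `θ.γ < 1`, the run's window), the γ-rows by `hε_of_window` ∕ `hε3_of_window` ∕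
`hε2_of_window`, the cube cover by dag-n11-w4's `cover_row_of_partCompat_of_nesting`. [cite: Balaban1988Convergent, Theorem p.245, Thm 1 p.262, §3 p.279, (2.4)–(2.5) p.255, (2.13) pp.256–257, (2.17) p.257, (3.24)–(3.25) p.270; Balaban1985Averaging, Prop. 2 p.26; Balaban1985Variational, Thm 1 (7)–(8) pp.278–279] -/
theorem noExpansionObligation_of_gaussCert_of_supplierBorel_of_nesting_of_logScalars
    (hζ : ∀ (p' : B12.RunParams) (n : ℕ) (Ω Λ : ℕ → Set (Site (F.P p'.K) 0)), (θ.Zh p' n Ω Λ).ζ0 = (ZhPinOfRecord₁₃ θ.toStage13Params p' Ω Λ).ζ0)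
    (hq : ∀ (p' : B12.RunParams) (n : ℕ) (Ω Λ : ℕ → Set (Site (F.P p'.K) 0)) (j : ℕ) (Λ' : Set (Site (F.P p'.K) 0)) (ω : MultiCfg (F.P p'.K) (SU N) (FluctV N)),
      (θ.Zh p' n Ω Λ).quad j Λ' ω = ∑ b ∈ (Set.toFinite (bondsIn j (Λ'ᶜ ∩ Ω (j + 1)))).toFinset, ‖(ω j).2 b‖ ^ 2)
    (h : θ.Provisos₁₃SepCoPH F N) (hθ : θ.Admissible F N) (hM₁ : 0 < θ.ν.M₁) (hle : θ.ν.M₁ ≤ θ.τ9.M) (hcR : 2 ≤ θ.s2.cR) (hdiv : F.L * θ.ν.M₂ ∣ θ.τ9.M)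
    (hM3 : (3 * θ.ν.M₁ : ℝ) ≤ F.L * θ.ν.M₂ * (Real.log (θ.γ ^ 2)⁻¹) ^ θ.ν.r)
    (hMd : (((4 + 4) * F.L + 3 : ℕ) : ℝ) ≤ F.L * θ.ν.M₂ * (Real.log (θ.γ ^ 2)⁻¹) ^ θ.ν.r)
    (hA : 0 < θ.ν.A₀) (hγ1 : θ.γ < 1) (hγp : θ.γ ≤ Real.exp (-(θ.ν.p₀ : ℝ)))
    (hg3 : (143 * ((((8 : ℕ) : ℝ)) ^ 2 / 4) ^ 2) * (θ.γ * (θ.ν.A₀ * (Real.log (θ.γ ^ 2)⁻¹) ^ θ.ν.p₀)) ≤ 1 / 3)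
    (hg2 : 2 * (θ.γ * (θ.ν.A₀ * (Real.log (θ.γ ^ 2)⁻¹) ^ θ.ν.p₀)) ≤ 2 * ExpMeanLog.deltaSU (Fin N) / (((8 * F.L : ℕ) : ℝ)) ^ 2)
    (hw : Step.InInterval θ.γ p.K (gOfRecord₁₃ F N θ.toStage13Params p)) (hPC : PartCompat₁₃ F N θ.toStage13Params p p.K)
    (hsolv : ∀ j, 1 ≤ j → j ≤ p.K →
      ∀ (s : SeqOfRecord F θ.ν θ.τ9.M (gOfRecord₁₃ F N θ.toStage13Params p) p.K j) (V : GaugeField (F.P p.K) j (SU N)),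
      chiSeqOfRecord F N θ.ν θ.τ9.M (gOfRecord₁₃ F N θ.toStage13Params p) p.K j s V ≠ 0 →
      ∀ a ∈ cubesIn (fun a : ↥(cubeIndices (F.P p.K) (cubeSide (F.P p.K).L θ.ν.M₂ (RkOfRecord (F.P p.K).L θ.ν.r (gOfRecord₁₃ F N θ.toStage13Params p j)) j)) =>
          cubeEnl (F.P p.K) (cubeSide (F.P p.K).L θ.ν.M₂ (RkOfRecord (F.P p.K).L θ.ν.r (gOfRecord₁₃ F N θ.toStage13Params p j)) j) a 0) (s.Ω j),
        ∃ U₀, IsMinimizer (avOfRecord F N p.K) {U | PlaqSmall (θ.ν.εreg * (F.P p.K).eta j ^ 2) U}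
          (Bj θ.ν.M₁ (cubeEnl (F.P p.K) (cubeSide (F.P p.K).L θ.ν.M₂ (RkOfRecord (F.P p.K).L θ.ν.r (gOfRecord₁₃ F N θ.toStage13Params p j)) j) a 4) j)
          (avgFamily (avOfRecord F N p.K) (qsstarGIter0 j V)) U₀)
    (σ : Sect3Supplier θ p) (hσB : SupplierBorel θ p σ) : NoExpansionObligation θ p σ :=
  noExpansionObligation_of_gaussCert_of_supplierBorel_of_solvable θ p hζ hq h hθ hM₁ hle hcR hw hPC (h3_of_log θ p hγ1.le hM3 hw) (hR_of_log θ p hγ1.le hMd hw) (hε_of_window θ p hA hγ1 hw)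
    (hε3_of_window θ p hA hγp hw hg3) (hε2_of_window θ p hA hγp hw hg2) hsolv (cover_row_of_partCompat_of_nesting θ p hdiv hPC)
    σ hσB

/-- **★★★ `SupplyChainAt θ p` AT A GAUSSIAN CERTIFICATE FROM SCALARS IN THE `M₂`-LIGHT REGIME** (supplier with `SupplierObligations` + `SupplierBorel`).
[cite: Balaban1988Convergent, Thm 1 p.262, Theorem p.245, §3 p.279, (3.24)–(3.25) p.270] -/
theorem supplyChainAt_of_gaussCert_of_supplierBorel_of_nesting_of_logScalars
    (hζ : ∀ (p' : B12.RunParams) (n : ℕ) (Ω Λ : ℕ → Set (Site (F.P p'.K) 0)), (θ.Zh p' n Ω Λ).ζ0 = (ZhPinOfRecord₁₃ θ.toStage13Params p' Ω Λ).ζ0)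
    (hq : ∀ (p' : B12.RunParams) (n : ℕ) (Ω Λ : ℕ → Set (Site (F.P p'.K) 0)) (j : ℕ) (Λ' : Set (Site (F.P p'.K) 0)) (ω : MultiCfg (F.P p'.K) (SU N) (FluctV N)),
      (θ.Zh p' n Ω Λ).quad j Λ' ω = ∑ b ∈ (Set.toFinite (bondsIn j (Λ'ᶜ ∩ Ω (j + 1)))).toFinset, ‖(ω j).2 b‖ ^ 2)
    (h : θ.Provisos₁₃SepCoPH F N) (hθ : θ.Admissible F N) (hM₁ : 0 < θ.ν.M₁) (hle : θ.ν.M₁ ≤ θ.τ9.M) (hcR : 2 ≤ θ.s2.cR) (hdiv : F.L * θ.ν.M₂ ∣ θ.τ9.M)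
    (hM3 : (3 * θ.ν.M₁ : ℝ) ≤ F.L * θ.ν.M₂ * (Real.log (θ.γ ^ 2)⁻¹) ^ θ.ν.r)
    (hMd : (((4 + 4) * F.L + 3 : ℕ) : ℝ) ≤ F.L * θ.ν.M₂ * (Real.log (θ.γ ^ 2)⁻¹) ^ θ.ν.r)
    (hA : 0 < θ.ν.A₀) (hγ1 : θ.γ < 1) (hγp : θ.γ ≤ Real.exp (-(θ.ν.p₀ : ℝ)))
    (hg3 : (143 * ((((8 : ℕ) : ℝ)) ^ 2 / 4) ^ 2) * (θ.γ * (θ.ν.A₀ * (Real.log (θ.γ ^ 2)⁻¹) ^ θ.ν.p₀)) ≤ 1 / 3)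
    (hg2 : 2 * (θ.γ * (θ.ν.A₀ * (Real.log (θ.γ ^ 2)⁻¹) ^ θ.ν.p₀)) ≤ 2 * ExpMeanLog.deltaSU (Fin N) / (((8 * F.L : ℕ) : ℝ)) ^ 2)
    (hw : Step.InInterval θ.γ p.K (gOfRecord₁₃ F N θ.toStage13Params p)) (hPC : PartCompat₁₃ F N θ.toStage13Params p p.K)
    (hsolv : ∀ j, 1 ≤ j → j ≤ p.K →
      ∀ (s : SeqOfRecord F θ.ν θ.τ9.M (gOfRecord₁₃ F N θ.toStage13Params p) p.K j) (V : GaugeField (F.P p.K) j (SU N)),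
      chiSeqOfRecord F N θ.ν θ.τ9.M (gOfRecord₁₃ F N θ.toStage13Params p) p.K j s V ≠ 0 →
      ∀ a ∈ cubesIn (fun a : ↥(cubeIndices (F.P p.K) (cubeSide (F.P p.K).L θ.ν.M₂ (RkOfRecord (F.P p.K).L θ.ν.r (gOfRecord₁₃ F N θ.toStage13Params p j)) j)) =>
          cubeEnl (F.P p.K) (cubeSide (F.P p.K).L θ.ν.M₂ (RkOfRecord (F.P p.K).L θ.ν.r (gOfRecord₁₃ F N θ.toStage13Params p j)) j) a 0) (s.Ω j),
        ∃ U₀, IsMinimizer (avOfRecord F N p.K) {U | PlaqSmall (θ.ν.εreg * (F.P p.K).eta j ^ 2) U}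
          (Bj θ.ν.M₁ (cubeEnl (F.P p.K) (cubeSide (F.P p.K).L θ.ν.M₂ (RkOfRecord (F.P p.K).L θ.ν.r (gOfRecord₁₃ F N θ.toStage13Params p j)) j) a 4) j)
          (avgFamily (avOfRecord F N p.K) (qsstarGIter0 j V)) U₀)
    (σ : Sect3Supplier θ p) (hσ : SupplierObligations θ p σ) (hσB : SupplierBorel θ p σ) : SupplyChainAt θ p :=
  ⟨σ, hσ, noExpansionObligation_of_gaussCert_of_supplierBorel_of_nesting_of_logScalars θ p hζ hq h hθ hM₁ hle hcR hdiv hM3 hMd hA hγ1 hγp hg3 hg2 hw hPC hsolv σ hσB⟩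

end RunLevel

section Printed

variable (θ : Stage13HParams F N)

/-- **★★★★ `B16.Thm1Printed` AT THE K1⁷-KEYED DATUM OF A GAUSSIAN-CLASS `θ` FROM SCALARS IN THE `M₂`-LIGHT REGIME** — per run in `]0, γ]`: `PartCompat₁₃` up to `K`, K0's
per-cube solvability, the supplier; the run's window is read off the datum. [cite: Balaban1988Convergent, Thm 1 p.262, Theorem p.245, §3 p.279, (0.2) p.244, (2.4)–(2.5) p.255; Balaban1989LargeFieldII, Thm 1 p.355; Balaban1987RG1, Thm 1 p.259] -/
theorem thm1Printed_datumOfRecord₁₃SepCoPH_of_gaussCert_of_supplierBorel_of_nesting_of_logScalars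
    (hζ : ∀ (p : B12.RunParams) (n : ℕ) (Ω Λ : ℕ → Set (Site (F.P p.K) 0)), (θ.Zh p n Ω Λ).ζ0 = (ZhPinOfRecord₁₃ θ.toStage13Params p Ω Λ).ζ0)
    (hq : ∀ (p : B12.RunParams) (n : ℕ) (Ω Λ : ℕ → Set (Site (F.P p.K) 0)) (j : ℕ) (Λ' : Set (Site (F.P p.K) 0)) (ω : MultiCfg (F.P p.K) (SU N) (FluctV N)),
      (θ.Zh p n Ω Λ).quad j Λ' ω = ∑ b ∈ (Set.toFinite (bondsIn j (Λ'ᶜ ∩ Ω (j + 1)))).toFinset, ‖(ω j).2 b‖ ^ 2)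
    (h : θ.Provisos₁₃SepCoPH F N) (hsel : θ.ppSel = ppSelLiveOfRecord F N θ.ν θ.τ9 (EOfRecord₁₃ F N θ.toStage13Params) (wOfRecord₉ F N θ.toStage9Params))
    (hθ : θ.Admissible F N) (hκ : 0 ≤ θ.s2.lf.κ) (hE₀ : 0 ≤ θ.s2.lf.E₀) (hB₀ : 0 ≤ θ.s2.lf.B₀) (hM₁ : 0 < θ.ν.M₁) (hle : θ.ν.M₁ ≤ θ.τ9.M) (hcR : 2 ≤ θ.s2.cR) (hdiv : F.L * θ.ν.M₂ ∣ θ.τ9.M)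
    (hM3 : (3 * θ.ν.M₁ : ℝ) ≤ F.L * θ.ν.M₂ * (Real.log (θ.γ ^ 2)⁻¹) ^ θ.ν.r)
    (hMd : (((4 + 4) * F.L + 3 : ℕ) : ℝ) ≤ F.L * θ.ν.M₂ * (Real.log (θ.γ ^ 2)⁻¹) ^ θ.ν.r)
    (hA : 0 < θ.ν.A₀) (hγ1 : θ.γ < 1) (hγp : θ.γ ≤ Real.exp (-(θ.ν.p₀ : ℝ)))
    (hg3 : (143 * ((((8 : ℕ) : ℝ)) ^ 2 / 4) ^ 2) * (θ.γ * (θ.ν.A₀ * (Real.log (θ.γ ^ 2)⁻¹) ^ θ.ν.p₀)) ≤ 1 / 3)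
    (hg2 : 2 * (θ.γ * (θ.ν.A₀ * (Real.log (θ.γ ^ 2)⁻¹) ^ θ.ν.p₀)) ≤ 2 * ExpMeanLog.deltaSU (Fin N) / (((8 * F.L : ℕ) : ℝ)) ^ 2) {γ : ℝ} (hγ : 0 < γ)
    (hPC : ∀ P : B12.RunParams, Step.InInterval γ P.K (gOfRecord₁₃ F N θ.toStage13Params P) → PartCompat₁₃ F N θ.toStage13Params P P.K)
    (hsolv : ∀ P : B12.RunParams, Step.InInterval γ P.K (gOfRecord₁₃ F N θ.toStage13Params P) → ∀ j, 1 ≤ j → j ≤ P.K →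
      ∀ (s : SeqOfRecord F θ.ν θ.τ9.M (gOfRecord₁₃ F N θ.toStage13Params P) P.K j) (V : GaugeField (F.P P.K) j (SU N)),
      chiSeqOfRecord F N θ.ν θ.τ9.M (gOfRecord₁₃ F N θ.toStage13Params P) P.K j s V ≠ 0 →
      ∀ a ∈ cubesIn (fun a : ↥(cubeIndices (F.P P.K) (cubeSide (F.P P.K).L θ.ν.M₂ (RkOfRecord (F.P P.K).L θ.ν.r (gOfRecord₁₃ F N θ.toStage13Params P j)) j)) =>
          cubeEnl (F.P P.K) (cubeSide (F.P P.K).L θ.ν.M₂ (RkOfRecord (F.P P.K).L θ.ν.r (gOfRecord₁₃ F N θ.toStage13Params P j)) j) a 0) (s.Ω j),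
        ∃ U₀, IsMinimizer (avOfRecord F N P.K) {U | PlaqSmall (θ.ν.εreg * (F.P P.K).eta j ^ 2) U}
          (Bj θ.ν.M₁ (cubeEnl (F.P P.K) (cubeSide (F.P P.K).L θ.ν.M₂ (RkOfRecord (F.P P.K).L θ.ν.r (gOfRecord₁₃ F N θ.toStage13Params P j)) j) a 4) j)
          (avgFamily (avOfRecord F N P.K) (qsstarGIter0 j V)) U₀)
    (σ : (P : B12.RunParams) → Sect3Supplier θ P) (hσ : ∀ P : B12.RunParams, Step.InInterval γ P.K (gOfRecord₁₃ F N θ.toStage13Params P) → SupplierObligations θ P (σ P))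
    (hσB : ∀ P : B12.RunParams, Step.InInterval γ P.K (gOfRecord₁₃ F N θ.toStage13Params P) → SupplierBorel θ P (σ P)) :
    B16.Thm1Printed (datumOfRecord₁₃SepCoPH F N θ h).C :=
  thm1Printed_datumOfRecord₁₃CoPH_of_obligations h.toCore hsel hθ hκ hE₀ hB₀ hθ.toStage9.2.2.2 (lt_min hγ hθ.toStage9.gamma_pos) σ
    (fun P hP => hσ P (step_inInterval_top_of_flow_inInterval_min θ h.toCore hP).1) fun P hP =>
    have hW := step_inInterval_top_of_flow_inInterval_min θ h.toCore hP
    noExpansionObligation_of_gaussCert_of_supplierBorel_of_nesting_of_logScalars θ P hζ hq h hθ hM₁ hle hcR hdiv hM3 hMd hA hγ1 hγp hg3 hg2 hW.2 (hPC P hW.1)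
      (hsolv P hW.1) (σ P) (hσB P hW.1)

/-- **★★★★★ `B16.Thm1Printed` AT THE K1⁷-KEYED DATUM OF THE NAMED CERTIFICATE `gaussPinH θ` FROM SCALARS IN THE `M₂`-LIGHT REGIME** — no class hypothesis.  Displayed: the key,
the live-selector line, `0 < M₁ ≤ M`, `2 ≤ cR`, `L·M₂ ∣ M`, `3·M₁ ≤ L·M₂·(log θ.γ⁻²)^r`, `8L + 3 ≤ L·M₂·(log θ.γ⁻²)^r`, `0 < A₀`, `θ.γ < 1`, `θ.γ ≤ e^(−p₀)`, the two edge
inequalities; `0 < γ`; per run in `]0, γ]`: `PartCompat₁₃`, K0's solvability, the supplier at the certificate. [cite: Balaban1988Convergent, Thm 1 p.262, Theorem p.245, §3 p.279, (0.2) p.244, (2.4)–(2.5) p.255, (3.24)–(3.25) p.270; Balaban1989LargeFieldII, Thm 1 p.355; Balaban1987RG1, Thm 1 p.259; Balaban1985Variational, Thm 1 (7)–(8) pp.278–279] -/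
theorem thm1Printed_datumOfRecord₁₃SepCoPH_gaussPinH_of_supplierBorel_of_nesting_of_logScalars
    (h : θ.Provisos₁₃SepCoPH F N) (hsel : θ.ppSel = ppSelLiveOfRecord F N θ.ν θ.τ9 (EOfRecord₁₃ F N θ.toStage13Params) (wOfRecord₉ F N θ.toStage9Params))
    (hθ : θ.Admissible F N) (hκ : 0 ≤ θ.s2.lf.κ) (hE₀ : 0 ≤ θ.s2.lf.E₀) (hB₀ : 0 ≤ θ.s2.lf.B₀) (hM₁ : 0 < θ.toStage13Params.ν.M₁) (hle : θ.toStage13Params.ν.M₁ ≤ θ.toStage13Params.τ9.M) (hcR : 2 ≤ θ.toStage13Params.s2.cR) (hdiv : F.L * θ.toStage13Params.ν.M₂ ∣ θ.toStage13Params.τ9.M)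
    (hM3 : (3 * θ.toStage13Params.ν.M₁ : ℝ) ≤ F.L * θ.toStage13Params.ν.M₂ * (Real.log (θ.toStage13Params.γ ^ 2)⁻¹) ^ θ.toStage13Params.ν.r)
    (hMd : (((4 + 4) * F.L + 3 : ℕ) : ℝ) ≤ F.L * θ.toStage13Params.ν.M₂ * (Real.log (θ.toStage13Params.γ ^ 2)⁻¹) ^ θ.toStage13Params.ν.r)
    (hA : 0 < θ.toStage13Params.ν.A₀) (hγ1 : θ.toStage13Params.γ < 1) (hγp : θ.toStage13Params.γ ≤ Real.exp (-(θ.toStage13Params.ν.p₀ : ℝ)))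
    (hg3 : (143 * ((((8 : ℕ) : ℝ)) ^ 2 / 4) ^ 2) * (θ.toStage13Params.γ * (θ.toStage13Params.ν.A₀ * (Real.log (θ.toStage13Params.γ ^ 2)⁻¹) ^ θ.toStage13Params.ν.p₀)) ≤ 1 / 3)
    (hg2 : 2 * (θ.toStage13Params.γ * (θ.toStage13Params.ν.A₀ * (Real.log (θ.toStage13Params.γ ^ 2)⁻¹) ^ θ.toStage13Params.ν.p₀)) ≤ 2 * ExpMeanLog.deltaSU (Fin N) / (((8 * F.L : ℕ) : ℝ)) ^ 2) {γ : ℝ} (hγ : 0 < γ)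
    (hPC : ∀ P : B12.RunParams, Step.InInterval γ P.K (gOfRecord₁₃ F N θ.toStage13Params P) → PartCompat₁₃ F N θ.toStage13Params P P.K)
    (hsolv : ∀ P : B12.RunParams, Step.InInterval γ P.K (gOfRecord₁₃ F N θ.toStage13Params P) → ∀ j, 1 ≤ j → j ≤ P.K →
      ∀ (s : SeqOfRecord F θ.toStage13Params.ν θ.toStage13Params.τ9.M (gOfRecord₁₃ F N θ.toStage13Params P) P.K j) (V : GaugeField (F.P P.K) j (SU N)),
      chiSeqOfRecord F N θ.toStage13Params.ν θ.toStage13Params.τ9.M (gOfRecord₁₃ F N θ.toStage13Params P) P.K j s V ≠ 0 →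
      ∀ a ∈ cubesIn (fun a : ↥(cubeIndices (F.P P.K) (cubeSide (F.P P.K).L θ.toStage13Params.ν.M₂ (RkOfRecord (F.P P.K).L θ.toStage13Params.ν.r (gOfRecord₁₃ F N θ.toStage13Params P j)) j)) =>
          cubeEnl (F.P P.K) (cubeSide (F.P P.K).L θ.toStage13Params.ν.M₂ (RkOfRecord (F.P P.K).L θ.toStage13Params.ν.r (gOfRecord₁₃ F N θ.toStage13Params P j)) j) a 0) (s.Ω j),
        ∃ U₀, IsMinimizer (avOfRecord F N P.K) {U | PlaqSmall (θ.toStage13Params.ν.εreg * (F.P P.K).eta j ^ 2) U}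
          (Bj θ.toStage13Params.ν.M₁ (cubeEnl (F.P P.K) (cubeSide (F.P P.K).L θ.toStage13Params.ν.M₂ (RkOfRecord (F.P P.K).L θ.toStage13Params.ν.r (gOfRecord₁₃ F N θ.toStage13Params P j)) j) a 4) j)
          (avgFamily (avOfRecord F N P.K) (qsstarGIter0 j V)) U₀)
    (σ : (P : B12.RunParams) → Sect3Supplier (gaussPinH θ) P)
    (hσ : ∀ P : B12.RunParams, Step.InInterval γ P.K (gOfRecord₁₃ F N θ.toStage13Params P) → SupplierObligations (gaussPinH θ) P (σ P))
    (hσB : ∀ P : B12.RunParams, Step.InInterval γ P.K (gOfRecord₁₃ F N θ.toStage13Params P) → SupplierBorel (gaussPinH θ) P (σ P)) :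
    B16.Thm1Printed (datumOfRecord₁₃SepCoPH F N (gaussPinH θ) (provisos₁₃SepCoPH_gaussPinH h)).C :=
  thm1Printed_datumOfRecord₁₃SepCoPH_of_gaussCert_of_supplierBorel_of_nesting_of_logScalars (gaussPinH θ) (gaussPinH_ζ0 θ) (gaussPinH_quad θ)
    (provisos₁₃SepCoPH_gaussPinH h) hsel hθ hκ hE₀ hB₀ hM₁ hle hcR hdiv hM3 hMd hA hγ1 hγp hg3 hg2 hγ hPC hsolv σ hσ hσB

end Printed

/-! ## §11  At any H-extension of a live re-pin, and at the all-numerics family `θ₁₃(n, ε₂₉)` (letters on `n`) -/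

section Families

variable {θ₀ : Stage13Params F N} {θ : Stage13HParams F N}

/-- **★★★★★ `B16.Thm1Printed` AT THE K1⁷-KEYED DATUM OF `gaussPinH θ`, `θ` ANY H-EXTENSION OF A LIVE RE-PIN `θ₀.liveRepin₁₃ F N`, `M₂`-LIGHT REGIME** (selector `rfl`,
`hθ₀.liveRepin₁₃`; letters on `θ₀`). [cite: Balaban1988Convergent, Thm 1 p.262, Theorem p.245, §3 p.279, (3.22) p.269, (0.2) p.244; Balaban1989LargeFieldII, Thm 1 p.355; Balaban1987RG1, Thm 1 p.259; Balaban1989LargeFieldI, (0.3)–(0.4) p.176] -/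
theorem thm1Printed_datumOfRecord₁₃SepCoPH_gaussPinH_liveRepinH_of_supplierBorel_of_nesting_of_logScalars
    (hθ : θ.toStage13Params = θ₀.liveRepin₁₃ F N) (hθ₀ : θ₀.Admissible F N) (hκ : 0 ≤ θ₀.s2.lf.κ) (hE₀ : 0 ≤ θ₀.s2.lf.E₀) (hB₀ : 0 ≤ θ₀.s2.lf.B₀)
    (h : θ.Provisos₁₃SepCoPH F N) (hM₁ : 0 < θ₀.ν.M₁) (hle : θ₀.ν.M₁ ≤ θ₀.τ9.M) (hcR : 2 ≤ θ₀.s2.cR) (hdiv : F.L * θ₀.ν.M₂ ∣ θ₀.τ9.M)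
    (hM3 : (3 * θ₀.ν.M₁ : ℝ) ≤ F.L * θ₀.ν.M₂ * (Real.log (θ₀.γ ^ 2)⁻¹) ^ θ₀.ν.r)
    (hMd : (((4 + 4) * F.L + 3 : ℕ) : ℝ) ≤ F.L * θ₀.ν.M₂ * (Real.log (θ₀.γ ^ 2)⁻¹) ^ θ₀.ν.r)
    (hA : 0 < θ₀.ν.A₀) (hγ1 : θ₀.γ < 1) (hγp : θ₀.γ ≤ Real.exp (-(θ₀.ν.p₀ : ℝ)))
    (hg3 : (143 * ((((8 : ℕ) : ℝ)) ^ 2 / 4) ^ 2) * (θ₀.γ * (θ₀.ν.A₀ * (Real.log (θ₀.γ ^ 2)⁻¹) ^ θ₀.ν.p₀)) ≤ 1 / 3)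
    (hg2 : 2 * (θ₀.γ * (θ₀.ν.A₀ * (Real.log (θ₀.γ ^ 2)⁻¹) ^ θ₀.ν.p₀)) ≤ 2 * ExpMeanLog.deltaSU (Fin N) / (((8 * F.L : ℕ) : ℝ)) ^ 2) {γ : ℝ} (hγ : 0 < γ)
    (hPC : ∀ P : B12.RunParams, Step.InInterval γ P.K (gOfRecord₁₃ F N θ.toStage13Params P) → PartCompat₁₃ F N θ.toStage13Params P P.K)
    (hsolv : ∀ P : B12.RunParams, Step.InInterval γ P.K (gOfRecord₁₃ F N θ.toStage13Params P) → ∀ j, 1 ≤ j → j ≤ P.K →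
      ∀ (s : SeqOfRecord F θ.toStage13Params.ν θ.toStage13Params.τ9.M (gOfRecord₁₃ F N θ.toStage13Params P) P.K j) (V : GaugeField (F.P P.K) j (SU N)),
      chiSeqOfRecord F N θ.toStage13Params.ν θ.toStage13Params.τ9.M (gOfRecord₁₃ F N θ.toStage13Params P) P.K j s V ≠ 0 →
      ∀ a ∈ cubesIn (fun a : ↥(cubeIndices (F.P P.K) (cubeSide (F.P P.K).L θ.toStage13Params.ν.M₂ (RkOfRecord (F.P P.K).L θ.toStage13Params.ν.r (gOfRecord₁₃ F N θ.toStage13Params P j)) j)) =>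
          cubeEnl (F.P P.K) (cubeSide (F.P P.K).L θ.toStage13Params.ν.M₂ (RkOfRecord (F.P P.K).L θ.toStage13Params.ν.r (gOfRecord₁₃ F N θ.toStage13Params P j)) j) a 0) (s.Ω j),
        ∃ U₀, IsMinimizer (avOfRecord F N P.K) {U | PlaqSmall (θ.toStage13Params.ν.εreg * (F.P P.K).eta j ^ 2) U}
          (Bj θ.toStage13Params.ν.M₁ (cubeEnl (F.P P.K) (cubeSide (F.P P.K).L θ.toStage13Params.ν.M₂ (RkOfRecord (F.P P.K).L θ.toStage13Params.ν.r (gOfRecord₁₃ F N θ.toStage13Params P j)) j) a 4) j)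
          (avgFamily (avOfRecord F N P.K) (qsstarGIter0 j V)) U₀)
    (σ : (P : B12.RunParams) → Sect3Supplier (gaussPinH θ) P)
    (hσ : ∀ P : B12.RunParams, Step.InInterval γ P.K (gOfRecord₁₃ F N θ.toStage13Params P) → SupplierObligations (gaussPinH θ) P (σ P))
    (hσB : ∀ P : B12.RunParams, Step.InInterval γ P.K (gOfRecord₁₃ F N θ.toStage13Params P) → SupplierBorel (gaussPinH θ) P (σ P)) :
    B16.Thm1Printed (datumOfRecord₁₃SepCoPH F N (gaussPinH θ) (provisos₁₃SepCoPH_gaussPinH h)).C := by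
  obtain ⟨⟨θ₁, Zr⟩, Zh, Phih⟩ := θ
  obtain rfl : θ₁ = _ := hθ
  exact thm1Printed_datumOfRecord₁₃SepCoPH_gaussPinH_of_supplierBorel_of_nesting_of_logScalars _ h rfl hθ₀.liveRepin₁₃ hκ hE₀ hB₀ hM₁ hle hcR hdiv hM3 hMd hA
    hγ1 hγp hg3 hg2 hγ hPC hsolv σ hσ hσB

variable {n : Stage12Numerics} {ε₂₉ : ℝ} {ζ : ZetaOfRecord F N n.ν n.τ9.M} {Rz : (K : ℕ) → Sect2.Residual (F.P K) (MatA N)}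
  {Zt : (K : ℕ) → TkResidualW F N (FluctV N) K}

/-- **★★★★★ `B16.Thm1Printed` AT THE K1⁷-KEYED DATUM OF `gaussPinH θ`, `θ` ANY H-EXTENSION OF THE ALL-NUMERICS WITNESS `θ₁₃(n, ε₂₉)`, `M₂`-LIGHT REGIME — THE HONEST
STATE OF N11 ON THE `SupplierBorel` ROAD IN NUMERALS OF `n`, WINDOW-TYPE LETTERS.**  Displayed EXACTLY: `n.Pos`, `0 < ε₂₉`, `0 ≤ κ, E₀, B₀`; the key; `0 < n.ν.M₁ ≤ n.τ9.M`,
`2 ≤ n.s2.cR`, `L·n.ν.M₂ ∣ n.τ9.M`, `3·n.ν.M₁ ≤ L·n.ν.M₂·(log n.γ⁻²)^(n.ν.r)`, `8L + 3 ≤ L·n.ν.M₂·(log n.γ⁻²)^(n.ν.r)`, `0 < n.ν.A₀`, `n.γ < 1`, `n.γ ≤ e^(−n.ν.p₀)`,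
`143·(8²∕4)²·ε(n.γ) ≤ 1∕3`, `2ε(n.γ) ≤ 2δ_N∕(8L)²`; SOME `γ > 0`; PER RUN IN `]0, γ]`: `PartCompat₁₃` up to `K`, K0's per-cube [15]-solvability, [III] §3's supplier at the
certificate. [cite: Balaban1988Convergent, Thm 1 p.262, Theorem p.245, §3 p.279, (3.22) p.269, (0.2) p.244, (2.4)–(2.5) p.255, (3.24)–(3.25) p.270; Balaban1989LargeFieldII, Thm 1 p.355; Balaban1987RG1, Thm 1 p.259, (0.21) p.256, (2.9) p.266; Balaban1989LargeFieldI, (0.3)–(0.4) p.176, p.177 (i)–(ii); Balaban1985Variational, Thm 1 (7)–(8) pp.278–279] -/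
theorem thm1Printed_datumOfRecord₁₃SepCoPH_gaussPinH_theta13LiveOfNumericsH_of_supplierBorel_of_nesting_of_logScalars
    (hθ : θ.toStage13Params = theta13LiveOfNumerics F N n ε₂₉ ζ Rz Zt) (hn : n.Pos) (hε' : 0 < ε₂₉)
    (hκ : 0 ≤ n.s2.lf.κ) (hE₀ : 0 ≤ n.s2.lf.E₀) (hB₀ : 0 ≤ n.s2.lf.B₀)
    (h : θ.Provisos₁₃SepCoPH F N) (hM₁ : 0 < n.ν.M₁) (hle : n.ν.M₁ ≤ n.τ9.M) (hcR : 2 ≤ n.s2.cR) (hdiv : F.L * n.ν.M₂ ∣ n.τ9.M)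
    (hM3 : (3 * n.ν.M₁ : ℝ) ≤ F.L * n.ν.M₂ * (Real.log (n.γ ^ 2)⁻¹) ^ n.ν.r)
    (hMd : (((4 + 4) * F.L + 3 : ℕ) : ℝ) ≤ F.L * n.ν.M₂ * (Real.log (n.γ ^ 2)⁻¹) ^ n.ν.r)
    (hA : 0 < n.ν.A₀) (hγ1 : n.γ < 1) (hγp : n.γ ≤ Real.exp (-(n.ν.p₀ : ℝ)))
    (hg3 : (143 * ((((8 : ℕ) : ℝ)) ^ 2 / 4) ^ 2) * (n.γ * (n.ν.A₀ * (Real.log (n.γ ^ 2)⁻¹) ^ n.ν.p₀)) ≤ 1 / 3)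
    (hg2 : 2 * (n.γ * (n.ν.A₀ * (Real.log (n.γ ^ 2)⁻¹) ^ n.ν.p₀)) ≤ 2 * ExpMeanLog.deltaSU (Fin N) / (((8 * F.L : ℕ) : ℝ)) ^ 2) {γ : ℝ} (hγ : 0 < γ)
    (hPC : ∀ P : B12.RunParams, Step.InInterval γ P.K (gOfRecord₁₃ F N θ.toStage13Params P) → PartCompat₁₃ F N θ.toStage13Params P P.K)
    (hsolv : ∀ P : B12.RunParams, Step.InInterval γ P.K (gOfRecord₁₃ F N θ.toStage13Params P) → ∀ j, 1 ≤ j → j ≤ P.K →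
      ∀ (s : SeqOfRecord F θ.toStage13Params.ν θ.toStage13Params.τ9.M (gOfRecord₁₃ F N θ.toStage13Params P) P.K j) (V : GaugeField (F.P P.K) j (SU N)),
      chiSeqOfRecord F N θ.toStage13Params.ν θ.toStage13Params.τ9.M (gOfRecord₁₃ F N θ.toStage13Params P) P.K j s V ≠ 0 →
      ∀ a ∈ cubesIn (fun a : ↥(cubeIndices (F.P P.K) (cubeSide (F.P P.K).L θ.toStage13Params.ν.M₂ (RkOfRecord (F.P P.K).L θ.toStage13Params.ν.r (gOfRecord₁₃ F N θ.toStage13Params P j)) j)) =>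
          cubeEnl (F.P P.K) (cubeSide (F.P P.K).L θ.toStage13Params.ν.M₂ (RkOfRecord (F.P P.K).L θ.toStage13Params.ν.r (gOfRecord₁₃ F N θ.toStage13Params P j)) j) a 0) (s.Ω j),
        ∃ U₀, IsMinimizer (avOfRecord F N P.K) {U | PlaqSmall (θ.toStage13Params.ν.εreg * (F.P P.K).eta j ^ 2) U}
          (Bj θ.toStage13Params.ν.M₁ (cubeEnl (F.P P.K) (cubeSide (F.P P.K).L θ.toStage13Params.ν.M₂ (RkOfRecord (F.P P.K).L θ.toStage13Params.ν.r (gOfRecord₁₃ F N θ.toStage13Params P j)) j) a 4) j)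
          (avgFamily (avOfRecord F N P.K) (qsstarGIter0 j V)) U₀)
    (σ : (P : B12.RunParams) → Sect3Supplier (gaussPinH θ) P)
    (hσ : ∀ P : B12.RunParams, Step.InInterval γ P.K (gOfRecord₁₃ F N θ.toStage13Params P) → SupplierObligations (gaussPinH θ) P (σ P))
    (hσB : ∀ P : B12.RunParams, Step.InInterval γ P.K (gOfRecord₁₃ F N θ.toStage13Params P) → SupplierBorel (gaussPinH θ) P (σ P)) :
    B16.Thm1Printed (datumOfRecord₁₃SepCoPH F N (gaussPinH θ) (provisos₁₃SepCoPH_gaussPinH h)).C :=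
  thm1Printed_datumOfRecord₁₃SepCoPH_gaussPinH_liveRepinH_of_supplierBorel_of_nesting_of_logScalars (θ₀ := theta13OfNumerics F N n ε₂₉ ζ Rz Zt) hθ
    (admissible_theta13OfNumerics F N ζ Rz Zt hn hε') hκ hE₀ hB₀ h hM₁ hle hcR hdiv hM3 hMd hA hγ1 hγp hg3 hg2 hγ hPC hsolv σ hσ hσB

end Families

end Summit.QuantumFields.YangMills.Theorems.BalabanUVNodesN11Sect3SupplyChainBorelBThm1PrintedOfLogScalars

end
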